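import Summits.BirchSwinnertonDyer.BirchSwinnertonDyer.Theorems.KimAtThreeSemiLocalTraceDualLevel
import Literature.NumberTheory.AdelicBaseChange.PadicTensorCompletionSurjProofs
import HarnessLib

/-!
# Route `KimAtThreeKolyvagin` (W2): the completions `ℚ(ζ_m)_w`, `w ∣ p`, are TRACE-SELF-DUAL when `p ∤ m`
# (`𝒪_w^∨ = 𝒪_w`; in general `p^{v_p(m)}·𝒪_w^∨ ⊆ 𝒪_w`) — the per-completion form of the seat's
# semi-local self-duality, stated WITHOUT `Ψ`

Cell `bsd-addord`, seat `bsd-addord-w2-acc3` (PROGRAMME PART 1b row (3), gen 5); fourth file of the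
trace-duality set (`KimAtThreeSemiLocalTraceDual{,Cyc,Level}`); `--supports stmt-BirchSwinnertonDyer-19679`
(helper).  TOOL theorems only (no definition, no named fact, no `sorry`); nothing about any curve.

WHY.  Two W2 roads compute a trace dual INSIDE ONE completion `L_w = ℚ(ζ_m)_w`: the uniform road's
crude bound (`exp*_ω(H¹(L_w,T)) ⊆ (log_ω E₁(L_w))^∨ = (p𝒪_w)^∨`) and seat w2-c4 gen 9's EXACT lattice
lemma on the good anomalous rows (memo W2C4-ANOMALOUS-PORT-g9 §2: `log_ω(E(K) ⊗ ℤ_p) = E_p(φ)⁻¹·𝒪_K` and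
`exp*_ω(H¹(K,T)) = E_p(φ⁻¹)·𝒪_K` "by trace duality" — the last step uses `𝒪_K^∨ = 𝒪_K` for the
unramified `K`).  This file supplies that local fact for every completion of `ℚ(ζ_m)` above `p ∤ m`,
derived from the semi-local statement (`KimAtThreeSemiLocalTraceDual` §4) by testing with the family
supported at one `w₀` and reading off the `w₀`-component through seat w2-acc4's INTO inclusion; no
different / discriminant / ramification theory is invoked.

* ★ `mem_adicCompletionIntegers_of_forall_trace_mul_mem` (`p ∤ m`): `a ∈ L_{w₀}` with
  `Tr_{L_{w₀}/ℚ_v}(a·o) ∈ 𝒪_v` for all `o ∈ 𝒪_{w₀}` lies in `𝒪_{w₀}`.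
* `mem_adicCompletionIntegers_iff_forall_trace_mul_mem` (`p ∤ m`): `𝒪_{w₀}^∨ = 𝒪_{w₀}` as an `iff`.
* `pow_padicValNat_mul_mem_adicCompletionIntegers_of_forall_trace_mul_mem` (any `m`):
  `p^{v_p(m)}·𝒪_{w₀}^∨ ⊆ 𝒪_{w₀}`.

References: [CasselsFrohlichANT1967] II §10–§11; J. Neukirch, *Algebraic Number Theory*, III (2.4)–(2.9)
(different of an unramified extension) [folklore]; [Kim2022StructureSelmer] §3.4.1.
-/

set_option autoImplicit false
-- the Theorems namespace of a single-conjunct summit repeats the summit name by design (D-0017)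
set_option linter.dupNamespace false
-- `CyclotomicField m ℚ`'s two `ℚ`-algebra structures agree only up to unfolding (as in the sibling files)
set_option backward.isDefEq.respectTransparency false

noncomputable section

open scoped TensorProduct NumberField
open NumberField Polynomial IsDedekindDomain
open Literature.NumberTheory.AdelicBaseChange
open Summit.BirchSwinnertonDyer.Rank1Residual.GaloisImage
open Summit.BirchSwinnertonDyer.BirchSwinnertonDyer.Theorems.KimAtThreePortSharedSATCore
open Summit.BirchSwinnertonDyer.BirchSwinnertonDyer.Theorems.KimAtThreeSemiLocalTraceDual
open Summit.BirchSwinnertonDyer.BirchSwinnertonDyer.Theorems.KimAtThreeSemiLocalTraceDualCyc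
open Summit.BirchSwinnertonDyer.BirchSwinnertonDyer.Theorems.KimAtThreeSemiLocalTraceDualLevel

namespace Summit.BirchSwinnertonDyer.BirchSwinnertonDyer.Theorems.KimAtThreeSemiLocalTraceDualLocal

variable (m : ℕ) [NeZero m] (p : ℕ) [Fact p.Prime]

omit [NeZero m] in
/-- A family supported at one place `w₀` whose `w₀`-component has `𝒪_v`-valued traces against `𝒪_{w₀}`
has every component in the corresponding trace dual (the other components are `0`). [folklore] -/
theorem forall_trace_single_mul_mem
    [DecidableEq (((Rat.HeightOneSpectrum.primesEquiv (R := 𝓞 ℚ)).symm ⟨p, Fact.out⟩).Extension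
      (𝓞 (CyclotomicField m ℚ)))]
    (w₀ : ((Rat.HeightOneSpectrum.primesEquiv (R := 𝓞 ℚ)).symm ⟨p, Fact.out⟩).Extension
      (𝓞 (CyclotomicField m ℚ)))
    (a : w₀.1.adicCompletion (CyclotomicField m ℚ))
    (ha : ∀ o ∈ w₀.1.adicCompletionIntegers (CyclotomicField m ℚ),
      Algebra.trace (((Rat.HeightOneSpectrum.primesEquiv (R := 𝓞 ℚ)).symm ⟨p, Fact.out⟩).adicCompletion ℚ)
          (w₀.1.adicCompletion (CyclotomicField m ℚ)) (a * o) ∈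
        (((Rat.HeightOneSpectrum.primesEquiv (R := 𝓞 ℚ)).symm ⟨p, Fact.out⟩).adicCompletionIntegers ℚ)) :
    ∀ w, ∀ o ∈ w.1.adicCompletionIntegers (CyclotomicField m ℚ),
      Algebra.trace (((Rat.HeightOneSpectrum.primesEquiv (R := 𝓞 ℚ)).symm ⟨p, Fact.out⟩).adicCompletion ℚ)
          (w.1.adicCompletion (CyclotomicField m ℚ))
          ((Pi.single (M := fun w : ((Rat.HeightOneSpectrum.primesEquiv (R := 𝓞 ℚ)).symm
              ⟨p, Fact.out⟩).Extension (𝓞 (CyclotomicField m ℚ)) => w.1.adicCompletion (CyclotomicField m ℚ))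
            w₀ a) w * o) ∈
        (((Rat.HeightOneSpectrum.primesEquiv (R := 𝓞 ℚ)).symm ⟨p, Fact.out⟩).adicCompletionIntegers ℚ) := by
  intro w o ho
  by_cases hw : w = w₀
  · subst hw
    rw [Pi.single_eq_same]
    exact ha o ho
  · rw [Pi.single_eq_of_ne hw, zero_mul, map_zero]
    exact zero_mem _

/-- ★ **`𝒪_w^∨ = 𝒪_w` for the completions of `ℚ(ζ_m)` above `p ∤ m`** ("`⊆`"): an element `a ∈ ℚ(ζ_m)_{w₀}`
with `Tr_{ℚ(ζ_m)_{w₀}/ℚ_v}(a·o) ∈ 𝒪_v` for every `o ∈ 𝒪_{w₀}` is a local integer.  Proof: seat w2-acc4's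
`Ψ` (`exists_padicTensorAlgEquiv`), the family `(a at w₀, 0 elsewhere)`, the semi-local statement
`symm_mem_span_ringOfIntegers_of_forall_trace_mul_mem`, and w2-acc4's INTO inclusion
`padicTensor_mem_adicCompletionIntegers_of_mem_span`. [cite: CasselsFrohlichANT1967, Ch. II §10 Theorem (10.2) and §11] -/
theorem mem_adicCompletionIntegers_of_forall_trace_mul_mem (hpm : ¬ p ∣ m)
    [Fintype (((Rat.HeightOneSpectrum.primesEquiv (R := 𝓞 ℚ)).symm ⟨p, Fact.out⟩).Extension
      (𝓞 (CyclotomicField m ℚ)))]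
    (w₀ : ((Rat.HeightOneSpectrum.primesEquiv (R := 𝓞 ℚ)).symm ⟨p, Fact.out⟩).Extension
      (𝓞 (CyclotomicField m ℚ)))
    (a : w₀.1.adicCompletion (CyclotomicField m ℚ))
    (ha : ∀ o ∈ w₀.1.adicCompletionIntegers (CyclotomicField m ℚ),
      Algebra.trace (((Rat.HeightOneSpectrum.primesEquiv (R := 𝓞 ℚ)).symm ⟨p, Fact.out⟩).adicCompletion ℚ)
          (w₀.1.adicCompletion (CyclotomicField m ℚ)) (a * o) ∈
        (((Rat.HeightOneSpectrum.primesEquiv (R := 𝓞 ℚ)).symm ⟨p, Fact.out⟩).adicCompletionIntegers ℚ)) :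
    a ∈ w₀.1.adicCompletionIntegers (CyclotomicField m ℚ) := by
  classical
  obtain ⟨Ψ, hΨ⟩ := exists_padicTensorAlgEquiv (CyclotomicField m ℚ) p
  have hmem := symm_mem_span_ringOfIntegers_of_forall_trace_mul_mem m p hpm Ψ hΨ _
    (forall_trace_single_mul_mem m p w₀ a ha)
  have h := padicTensor_mem_adicCompletionIntegers_of_mem_span
    (Ψ : ℚ_[p] ⊗[ℚ] CyclotomicField m ℚ →ₐ[ℚ] _) hΨ hmem w₀
  change Ψ (Ψ.symm _) w₀ ∈ _ at h
  rwa [Ψ.apply_symm_apply, Pi.single_eq_same] at h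

/-- **`𝒪_w^∨ = 𝒪_w` (`p ∤ m`) as an `iff`**: `a ∈ 𝒪_{w₀}` iff all `Tr(a·o)`, `o ∈ 𝒪_{w₀}`, are in `𝒪_v`
(⇒: the trace of a local integer is a local integer — read off w2-acc4's `padicTensor_trace` on `Ψ` of an
element of `L_int′`; ⇐: ★). [cite: CasselsFrohlichANT1967, Ch. II §10 Theorem (10.2) and §11] -/
theorem mem_adicCompletionIntegers_iff_forall_trace_mul_mem (hpm : ¬ p ∣ m)
    [Fintype (((Rat.HeightOneSpectrum.primesEquiv (R := 𝓞 ℚ)).symm ⟨p, Fact.out⟩).Extension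
      (𝓞 (CyclotomicField m ℚ)))]
    (w₀ : ((Rat.HeightOneSpectrum.primesEquiv (R := 𝓞 ℚ)).symm ⟨p, Fact.out⟩).Extension
      (𝓞 (CyclotomicField m ℚ)))
    (a : w₀.1.adicCompletion (CyclotomicField m ℚ)) :
    a ∈ w₀.1.adicCompletionIntegers (CyclotomicField m ℚ) ↔
      ∀ o ∈ w₀.1.adicCompletionIntegers (CyclotomicField m ℚ),
        Algebra.trace (((Rat.HeightOneSpectrum.primesEquiv (R := 𝓞 ℚ)).symm ⟨p, Fact.out⟩).adicCompletion ℚ)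
            (w₀.1.adicCompletion (CyclotomicField m ℚ)) (a * o) ∈
          (((Rat.HeightOneSpectrum.primesEquiv (R := 𝓞 ℚ)).symm ⟨p, Fact.out⟩).adicCompletionIntegers ℚ) := by
  classical
  refine ⟨fun ha o ho => ?_, mem_adicCompletionIntegers_of_forall_trace_mul_mem m p hpm w₀ a⟩
  -- `Tr_{w₀}(a·o)`: put `a·o ∈ 𝒪_{w₀}` at `w₀`, `0` elsewhere; it is `Ψ t` with `t ∈ L_int′` (ONTO), and
  -- `e_p(Tr t) = Σ_w Tr_w((Ψ t)_w) = Tr_{w₀}(a·o)` with `‖Tr t‖ ≤ 1`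
  obtain ⟨Ψ, hΨ⟩ := exists_padicTensorAlgEquiv (CyclotomicField m ℚ) p
  set y : Π w : ((Rat.HeightOneSpectrum.primesEquiv (R := 𝓞 ℚ)).symm ⟨p, Fact.out⟩).Extension
      (𝓞 (CyclotomicField m ℚ)), w.1.adicCompletion (CyclotomicField m ℚ) := Pi.single w₀ (a * o) with hy
  have hyint : ∀ w, y w ∈ w.1.adicCompletionIntegers (CyclotomicField m ℚ) := by
    intro w
    by_cases hw : w = w₀
    · subst hw; rw [hy, Pi.single_eq_same]; exact mul_mem ha ho
    · rw [hy, Pi.single_eq_of_ne hw]; exact zero_mem _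
  obtain ⟨t, ht, hty⟩ := exists_mem_span_padicTensor_eq (Ψ : ℚ_[p] ⊗[ℚ] CyclotomicField m ℚ →ₐ[ℚ] _) hΨ y hyint
  have htr := padicTensor_trace Ψ hΨ t
  have hΨt : Ψ t = y := hty
  rw [hΨt, Fintype.sum_eq_single w₀ (fun w hw => by rw [hy, Pi.single_eq_of_ne hw, map_zero]), hy,
    Pi.single_eq_same] at htr
  rw [← htr]
  obtain ⟨r, hr⟩ := exists_padicInt_coe_eq_of_norm_le_one (p := p)
    (KimAtThreeFineKatoSemiLocalLatticeInt.norm_trace_le_one_of_mem_span_ringOfIntegers p m ht)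
  rw [← hr, ← PadicInt.coe_adicCompletionIntegersEquiv_apply]
  exact (PadicInt.adicCompletionIntegersEquiv (𝓞 ℚ) ⟨p, Fact.out⟩ r).2

/-- **`p^{v_p(m)}·𝒪_{w₀}^∨ ⊆ 𝒪_{w₀}` at every level `m`** (the different of `ℚ(ζ_m)_{w₀}/ℚ_v` divides
`p^{v_p(m)}`): if `Tr(a·o) ∈ 𝒪_v` for all `o ∈ 𝒪_{w₀}` then `p^{v_p(m)}·a ∈ 𝒪_{w₀}`.  (`…Level`'s
`pow_padicValNat_smul_symm_mem_cycIntLattice_of_forall_trace_mul_mem` on the family supported at `w₀`,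
`cycIntLattice ≤ L_int′`, w2-acc4's INTO inclusion and `e_p`-semilinearity of `Ψ`.)
[cite: CasselsFrohlichANT1967, Ch. II §10 Theorem (10.2) and §11] -/
theorem pow_padicValNat_mul_mem_adicCompletionIntegers_of_forall_trace_mul_mem
    [Fintype (((Rat.HeightOneSpectrum.primesEquiv (R := 𝓞 ℚ)).symm ⟨p, Fact.out⟩).Extension
      (𝓞 (CyclotomicField m ℚ)))]
    (w₀ : ((Rat.HeightOneSpectrum.primesEquiv (R := 𝓞 ℚ)).symm ⟨p, Fact.out⟩).Extension
      (𝓞 (CyclotomicField m ℚ)))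
    (a : w₀.1.adicCompletion (CyclotomicField m ℚ))
    (ha : ∀ o ∈ w₀.1.adicCompletionIntegers (CyclotomicField m ℚ),
      Algebra.trace (((Rat.HeightOneSpectrum.primesEquiv (R := 𝓞 ℚ)).symm ⟨p, Fact.out⟩).adicCompletion ℚ)
          (w₀.1.adicCompletion (CyclotomicField m ℚ)) (a * o) ∈
        (((Rat.HeightOneSpectrum.primesEquiv (R := 𝓞 ℚ)).symm ⟨p, Fact.out⟩).adicCompletionIntegers ℚ)) :
    (p : w₀.1.adicCompletion (CyclotomicField m ℚ)) ^ padicValNat p m * a ∈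
      w₀.1.adicCompletionIntegers (CyclotomicField m ℚ) := by
  classical
  obtain ⟨Ψ, hΨ⟩ := exists_padicTensorAlgEquiv (CyclotomicField m ℚ) p
  have hmem := pow_padicValNat_smul_symm_mem_cycIntLattice_of_forall_trace_mul_mem m p Ψ hΨ _
    (forall_trace_single_mul_mem m p w₀ a ha)
  have hmem' := KimAtThreeFineKatoSemiLocalLattice.cycIntLattice_le_span_ringOfIntegers p m hmem
  have h := padicTensor_mem_adicCompletionIntegers_of_mem_span
    (Ψ : ℚ_[p] ⊗[ℚ] CyclotomicField m ℚ →ₐ[ℚ] _) hΨ hmem' w₀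
  rw [padicInt_smul_eq_coe_smul,
    padicTensor_map_smul (Ψ : ℚ_[p] ⊗[ℚ] CyclotomicField m ℚ →ₐ[ℚ] _) hΨ] at h
  change _ * Ψ (Ψ.symm _) w₀ ∈ _ at h
  rw [Ψ.apply_symm_apply, Pi.single_eq_same] at h
  have hcast : algebraMap (((Rat.HeightOneSpectrum.primesEquiv (R := 𝓞 ℚ)).symm ⟨p, Fact.out⟩).adicCompletion ℚ)
      (w₀.1.adicCompletion (CyclotomicField m ℚ))
      (Padic.adicCompletionEquiv (𝓞 ℚ) ⟨p, Fact.out⟩ (((p ^ padicValNat p m : ℕ) : ℤ_[p]) : ℚ_[p])) =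
      (p : w₀.1.adicCompletion (CyclotomicField m ℚ)) ^ padicValNat p m := by
    rw [PadicInt.coe_natCast, map_natCast, map_natCast, Nat.cast_pow]
  rwa [hcast] at h

end Summit.BirchSwinnertonDyer.BirchSwinnertonDyer.Theorems.KimAtThreeSemiLocalTraceDualLocal

end
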